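import Summits.QuantumFields.YangMills.Theorems.BalabanUVNodesN15KingModelInfiniteVolumeSymmetries
import Literature.Probability.LatticeModels.GaussianFieldReflectionPositivity
import Literature.MathematicalPhysics.QuantumFieldTheory.LatticeMassGap

/-!
# BalabanUVNodes ∕ N15 — THE KING-MODEL RUNG (PART Ͳ-c₁): KING's INFINITE-VOLUME BLOCK FIELD `μ_∞` IS REFLECTION POSITIVE ON ALL BOUNDED POSITIVE-TIME OBSERVABLES —
# for the time reflection between sites AND for the site reflection on `{x₀ ≥ 1}` — IT IS REFLECTION AND SHIFT INVARIANT, AND ITS ONE-STEP SHIFT IS POSITIVE: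
# every premise of the tree's lattice Osterwalder–Schrader reconstruction (`IsRPMeasureData` + one-step positivity), assembled by name in part Ͳ-c₂
# (Track A, DAG node N15 = NE2; FAN-OUT v1.1 §N15 s3 «KING-MODEL RUNG»; count-neutral)

HONEST FRAMING.  Count-neutral (cell `pub-ymgap`, seat `pub-ymgap-dag-n15-e` g36; `--supports stmt-QuantumFields-27366 --as helper` = K3⁸).  King's `A = 0`, `g = 0` model
([King1986] C. King, Commun. Math. Phys. **102** (1986) 649–677): the FREE massive block field `μ_∞ = N(0, S₂^{ℝ}(w − z))` on `ℝ^{ℤ^{d+1}}` of part Ϻ-n.  Time is the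
coordinate `0`; the tree's lattice OS data (`Literature.MathematicalPhysics.QuantumFieldTheory.LatticeMassGap`): time reflection between sites `θ x = (−1 − x₀, x_⊥)`
(`latticeTimeReflection (d+1)`), unit time shift `(Sφ)(x) = φ(x + e₀)` (`latticeTimeShift (d+1) ℝ`), positive-time σ-algebra `σ(φ(x) : x₀ ≥ 0)` (`positiveTimeEvents (d+1) ℝ`).
★★★ **`μ_∞` IS REFLECTION POSITIVE ON ALL BOUNDED POSITIVE-TIME OBSERVABLES** (`king_isReflectionPositive`: the tree's `IsReflectionPositive`, Glimm–Jaffe Thm. 6.2.2 for the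
lattice free field) — from part Ϸ-k's reflection positivity of the COVARIANCE through the generic Gaussian coupling theorem
`Literature.Probability.LatticeModels.gaussianField_isReflectionPositive` (bounded local observables by the coupling `(Z+U, Z+U′)`, all bounded ones by Lévy's
upward theorem); ★★ the same for the SITE reflection `x₀ ↦ −x₀` on `{x₀ ≥ 1}` (`king_isReflectionPositive_site`, from the new covariance estimate
★ `kingS2Inf_site_reflection_positive`); `μ_∞` is reflection invariant and shift invariant (parts Ϻ-n∕Ϻ-p, re-read in the tree's lattice vocabulary); and ★★ THE ONE-STEP SHIFT IS POSITIVE,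
`0 ≤ Re ∫ conj F(θφ)·F(Sφ) dμ_∞` for every bounded positive-time `F` (`king_shift_nonneg` — reflection positivity about the half-integer hyperplane; it makes the reconstructed
one-step transfer operator POSITIVE).  Part Ͳ-c₂ feeds these to the tree's `isRPMeasureData_lattice` ∕ `isOSRealisation_of_isRPMeasureData`.  NOT Bałaban's objects; NOT a node
discharge; nothing about Yang–Mills ∕ continuum ∕ `ℝ⁴` ∕ Clay.  0 `sorry`, 0 def; standard axioms.

WHAT THIS FILE PROVES (kernel).  §1 `latticeTimeReflection_eq_update`, `kingKernel_latticeTimeReflection`, `sum_sum_kingKernel_latticeTimeReflection_nonneg`,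
★★★ **`king_isReflectionPositive`**, `king_isReflectionInvariant`, `king_measurePreserving_latticeTimeShift`;
§2 `siteReflection_apply`, `siteReflection_involutive`, `update_neg_eq_reflect_sub_single`, ★ `kingS2Inf_site_reflection_positive`, `kingKernel_siteReflection`,
`sum_sum_kingKernel_siteReflection_nonneg`, ★★ `king_isReflectionPositive_site`; §3 `measurable_comp_latticeTimeShift_site`, `siteReflection_add_single`,
★★ **`king_shift_nonneg`**.

HONEST SCOPE.  King's free infinite-volume block field only (`m² > 0`, every `d`).  N15 untouched; counts unmoved.
Locators (use): [King1986] Thm 2.1 (2.22)–(2.23) p.654, (4.5) p.670; Glimm–Jaffe 1987 §6.1 Thm. 6.1.3, §6.2 Thm. 6.2.2; Osterwalder–Seiler 1978 §2.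
-/

noncomputable section

open scoped BigOperators
open MeasureTheory ProbabilityTheory Finset

namespace Summit.QuantumFields.YangMills.BalabanUVNodes.N15KingModelRung.InfiniteVolume

open Literature.MathematicalPhysics.QuantumFieldTheory (IsPosSemidefKernel gaussianFieldOfKernel isProbabilityMeasure_gaussianFieldOfKernel
  latticeTimeReflection latticeTimeReflection_apply latticeTimeReflection_involutive positiveTimeSites positiveTimeEvents latticeTimeShift
  latticeTimeShift_apply)
open Literature.Probability.LatticeModels (Site configReflect configReflect_apply IsReflectionInvariant IsReflectionPositive positiveEvents
  IsBoundedMeasurable gaussianField_isReflectionPositive gaussianField_isReflectionInvariant)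
open Summit.QuantumFields.YangMills.BalabanUVNodes.N15KingModelRung.OptimalDecay

variable {d : ℕ}

/-! ## §1 Bond reflection: `μ_∞` is reflection positive on all bounded positive-time observables; reflection and shift invariance -/

/-- The tree's time reflection between sites is King's block reflection in direction `0`: `θ x = (−x₀ − 1, x_⊥)`. [cite: OsterwalderSeiler1978, §2] -/
theorem latticeTimeReflection_eq_update (x : Fin (d + 1) → ℤ) :
    latticeTimeReflection (d + 1) x = Function.update x 0 (-(x 0) - 1) := by
  rw [latticeTimeReflection_apply]
  congr 1
  ring

/-- King's kernel is invariant under the time reflection: `K(θz, θw) = K(z, w)`. [cite: King1986, Thm 2.1 (2.22) p.654] -/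
theorem kingKernel_latticeTimeReflection (m2 : ℝ) (z w : Fin (d + 1) → ℤ) :
    kingKernel m2 (latticeTimeReflection (d + 1) z) (latticeTimeReflection (d + 1) w) = kingKernel m2 z w := by
  rw [kingKernel_apply, kingKernel_apply, latticeTimeReflection_eq_update, latticeTimeReflection_eq_update, kingS2Inf_reflect_sub_reflect]

/-- The reflected Gram sums of King's kernel on the positive-time half are non-negative (part Ϸ-k's `kingS2Inf_reflection_positive`, direction `0`).
[cite: King1986, Thm 2.1 (2.22) p.654, (4.5) p.670] -/
theorem sum_sum_kingKernel_latticeTimeReflection_nonneg {m2 : ℝ} (hm : 0 < m2) (ι : Type) (s : Finset ι) (c : ι → ℝ) (z : ι → Fin (d + 1) → ℤ)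
    (hz : ∀ i ∈ s, z i ∈ positiveTimeSites (d + 1)) :
    0 ≤ ∑ i ∈ s, ∑ j ∈ s, c i * c j * kingKernel m2 (latticeTimeReflection (d + 1) (z i)) (z j) := by
  have h := kingS2Inf_reflection_positive hm 0 s c z fun i hi => hz i hi
  refine h.trans_eq (Finset.sum_congr rfl fun i _ => Finset.sum_congr rfl fun j _ => ?_)
  rw [kingKernel_apply, latticeTimeReflection_eq_update, ← kingS2Inf_neg m2 (z j - _), neg_sub]

/-- ★★★ **KING's INFINITE-VOLUME BLOCK FIELD IS REFLECTION POSITIVE ON ALL BOUNDED POSITIVE-TIME OBSERVABLES**: `0 ≤ Re ∫ conj F(φ∘θ)·F(φ) dμ_∞` for every bounded complex `F`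
measurable in `{φ(x) : x₀ ≥ 0}` (the tree's `IsReflectionPositive`; Glimm–Jaffe Thm. 6.2.2 for King's free block field — covariance RP (part Ϸ-k) + the Gaussian coupling theorem
+ Lévy's upward theorem). [cite: King1986, Thm 2.1 (2.22) p.654; GlimmJaffe1987, §6.2 Thm. 6.2.2] -/
theorem king_isReflectionPositive {m2 : ℝ} (hm : 0 < m2) :
    IsReflectionPositive (kingFieldInf (d := d) m2) (latticeTimeReflection (d + 1)) (positiveTimeSites (d + 1)) :=
  gaussianField_isReflectionPositive (isPosSemidefKernel_kingKernel hm) (latticeTimeReflection (d + 1)) (kingKernel_latticeTimeReflection m2)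
    (latticeTimeReflection_involutive (d + 1)) (sum_sum_kingKernel_latticeTimeReflection_nonneg hm)

/-- `μ_∞` is invariant under the time reflection (part Ϻ-p). [cite: King1986, Thm 2.1 (2.22) p.654] -/
theorem king_isReflectionInvariant {m2 : ℝ} (hm : 0 < m2) : IsReflectionInvariant (kingFieldInf (d := d) m2) (latticeTimeReflection (d + 1)) :=
  gaussianField_isReflectionInvariant (isPosSemidefKernel_kingKernel hm) (latticeTimeReflection (d + 1)) (kingKernel_latticeTimeReflection m2)

/-- `μ_∞` is invariant under the unit time shift (part Ϻ-n's translation invariance). [cite: King1986, Thm 2.1 (2.22) p.654] -/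
theorem king_measurePreserving_latticeTimeShift {m2 : ℝ} (hm : 0 < m2) :
    MeasurePreserving (latticeTimeShift (d + 1) ℝ) (kingFieldInf (d := d) m2) (kingFieldInf m2) := by
  refine ⟨(latticeTimeShift (d + 1) ℝ).measurable, ?_⟩
  have h := kingFieldInf_map_shift' (d := d) hm ((Pi.single 0 1 : Fin (d + 1) → ℤ))
  exact h

/-! ## §2 Site reflection `x₀ ↦ −x₀` on `{x₀ ≥ 1}`: reflection positivity about the half-integer hyperplane -/

/-- The site time reflection `x ↦ (−x₀, x_⊥)` written with tree vocabulary: `θ` followed by the unit time translation. [cite: FILS1978, §2] -/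
theorem siteReflection_apply (x : Fin (d + 1) → ℤ) :
    ((latticeTimeReflection (d + 1)).trans (Equiv.addRight (Pi.single 0 1 : Fin (d + 1) → ℤ))) x = Function.update x 0 (-(x 0)) := by
  simp only [Equiv.trans_apply, Equiv.coe_addRight, latticeTimeReflection_apply]
  ext j
  by_cases hj : j = 0
  · subst hj; simp; ring
  · simp [hj]

/-- The site reflection is an involution. [cite: FILS1978, §2] -/
theorem siteReflection_involutive :
    Function.Involutive ((latticeTimeReflection (d + 1)).trans (Equiv.addRight (Pi.single 0 1 : Fin (d + 1) → ℤ))) := by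
  intro x
  rw [siteReflection_apply, siteReflection_apply]
  ext j
  by_cases hj : j = 0
  · subst hj; simp
  · simp [hj]

/-- `(−z₀, z_⊥) = θ(z − e₀)`: the site reflection of `z` is the bond reflection of `z − e₀`. [cite: FILS1978, §2] -/
theorem update_neg_eq_reflect_sub_single (z : Fin (d + 1) → ℤ) :
    Function.update z 0 (-(z 0)) = Function.update (z - (Pi.single 0 1 : Fin (d + 1) → ℤ)) 0 (-((z - (Pi.single 0 1 : Fin (d + 1) → ℤ)) 0) - 1) := by
  ext j
  by_cases hj : j = 0
  · subst hj; simp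
  · simp [hj]

/-- ★ **REFLECTION POSITIVITY OF `S₂^{ℝ}` UNDER THE SITE REFLECTION ON `{x₀ ≥ 1}`**: `0 ≤ Σ_{i,j} c_i c_j S₂^{ℝ}((−z_{i,0}, z_{i,⊥}) − z_j)` for `z_{i,0} ≥ 1` — the Laplace representation at
`|t| = z_{i,0} + z_{j,0} ≥ 1` (part Ϸ-j) is the sum of squares `P·W·e^{−M}[(Σc_i e^{−M(z_{i,0}−½)}cos φ_i)² + (…sin…)²]` (continuum RP about the hyperplane `t = ½`).
[cite: King1986, (4.5) p.670, (4.36) p.674, Thm 2.1 (2.22) p.654] -/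
theorem kingS2Inf_site_reflection_positive {m2 : ℝ} (hm : 0 < m2) {ι : Type*} (s : Finset ι) (c : ι → ℝ) (z : ι → Fin (d + 1) → ℤ)
    (hz : ∀ i ∈ s, 1 ≤ z i 0) :
    0 ≤ ∑ i ∈ s, ∑ j ∈ s, c i * c j * kingS2Inf m2 (Function.update (z i) 0 (-(z i 0)) - z j) := by
  -- the reflected kernels, through the bond representation at `z_i − e₀ ∈ {x₀ ≥ 0}`
  have hz' : ∀ i ∈ s, 0 ≤ (z i - (Pi.single 0 1 : Fin (d + 1) → ℤ)) 0 := fun i hi => by simp; linarith [hz i hi]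
  have hz0 : ∀ i ∈ s, 0 ≤ z i 0 := fun i hi => by linarith [hz i hi]
  set G : ι → ι → (Fin d → ℝ) → ℝ := fun i j q => Real.cos ((∑ k, q k * (z i - (Pi.single 0 1 : Fin (d + 1) → ℤ)) ((0 : Fin (d + 1)).succAbove k)) - ∑ k, q k * z j ((0 : Fin (d + 1)).succAbove k))
      * ((∏ l, Real.sinc (q l / 2) ^ 2) * (2 * Real.pi * (Real.cosh (Real.sqrt ((∑ l, q l ^ 2) + m2)) - 1) / Real.sqrt ((∑ l, q l ^ 2) + m2) ^ 3
          * Real.exp (-(Real.sqrt ((∑ l, q l ^ 2) + m2) * |((z i - (Pi.single 0 1 : Fin (d + 1) → ℤ)) 0 : ℝ) + z j 0 + 1|)))) with hG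
  have hGint : ∀ i ∈ s, ∀ j ∈ s, Integrable (G i j) := fun i hi j hj => integrable_reflectKernel hm 0 (hz' i hi) (hz0 j hj)
  have hterm : ∀ i ∈ s, ∀ j ∈ s, c i * c j * kingS2Inf m2 (Function.update (z i) 0 (-(z i 0)) - z j)
      = ((2 * Real.pi) ^ (d + 1))⁻¹ * ∫ q, c i * c j * G i j q := by
    intro i hi j hj
    rw [update_neg_eq_reflect_sub_single, kingS2Inf_reflect_sub_eq hm 0 (hz' i hi) (hz0 j hj), integral_const_mul]
    ring
  rw [Finset.sum_congr rfl fun i hi => Finset.sum_congr rfl fun j hj => hterm i hi j hj]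
  have hswap : ∑ i ∈ s, ∑ j ∈ s, ((2 * Real.pi) ^ (d + 1))⁻¹ * ∫ q, c i * c j * G i j q
      = ((2 * Real.pi) ^ (d + 1))⁻¹ * ∫ q, ∑ i ∈ s, ∑ j ∈ s, c i * c j * G i j q := by
    rw [integral_finsetSum _ (fun i hi => integrable_finsetSum _ fun j hj => (hGint i hi j hj).const_mul _), Finset.mul_sum]
    refine Finset.sum_congr rfl fun i hi => ?_
    rw [integral_finsetSum _ (fun j hj => (hGint i hi j hj).const_mul _), Finset.mul_sum]
  rw [hswap]
  refine mul_nonneg (by positivity) (integral_nonneg fun q => ?_)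
  -- pointwise: rewrite into the sum-of-squares form with `a_i = z_{i,0} − ½`
  have hperp : ∀ i, (∑ k, q k * ((z i - (Pi.single 0 1 : Fin (d + 1) → ℤ)) ((0 : Fin (d + 1)).succAbove k) : ℝ)) = ∑ k, q k * (z i ((0 : Fin (d + 1)).succAbove k) : ℝ) := by
    intro i
    refine Finset.sum_congr rfl fun k _ => ?_
    rw [Pi.sub_apply, Pi.single_eq_of_ne (Fin.succAbove_ne 0 k), sub_zero]
  have habs : ∀ i j, |(((z i - (Pi.single 0 1 : Fin (d + 1) → ℤ)) 0 : ℤ) : ℝ) + z j 0 + 1| = |((z i 0 : ℝ) - 1 / 2) + ((z j 0 : ℝ) - 1 / 2) + 1| := by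
    intro i j
    congr 1
    simp only [Pi.sub_apply, Pi.single_eq_same, Int.cast_sub, Int.cast_one]
    ring
  have hGq : ∀ i j, c i * c j * G i j q = c i * c j * (Real.cos ((∑ k, q k * (z i ((0 : Fin (d + 1)).succAbove k) : ℝ)) - ∑ k, q k * (z j ((0 : Fin (d + 1)).succAbove k) : ℝ))
      * ((∏ l, Real.sinc (q l / 2) ^ 2) * (2 * Real.pi * (Real.cosh (Real.sqrt ((∑ l, q l ^ 2) + m2)) - 1) / Real.sqrt ((∑ l, q l ^ 2) + m2) ^ 3
          * Real.exp (-(Real.sqrt ((∑ l, q l ^ 2) + m2) * |((z i 0 : ℝ) - 1 / 2) + ((z j 0 : ℝ) - 1 / 2) + 1|))))) := by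
    intro i j
    simp only [hG]
    rw [hperp i, habs i j]
  rw [Finset.sum_congr rfl fun i _ => Finset.sum_congr rfl fun j _ => hGq i j]
  have ha : ∀ i ∈ s, (0 : ℝ) ≤ (z i 0 : ℝ) - 1 / 2 := fun i hi => by
    have : (1 : ℝ) ≤ z i 0 := by exact_mod_cast hz i hi
    linarith
  have hc1 : 0 ≤ Real.cosh (Real.sqrt ((∑ l, q l ^ 2) + m2)) - 1 := by linarith [Real.one_le_cosh (Real.sqrt ((∑ l, q l ^ 2) + m2))]
  exact sum_sum_mul_cos_sub_mul_exp_nonneg s c (fun i => (z i 0 : ℝ) - 1 / 2) (fun i => ∑ k, q k * (z i ((0 : Fin (d + 1)).succAbove k) : ℝ))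
    (P := ∏ l, Real.sinc (q l / 2) ^ 2) (W := 2 * Real.pi * (Real.cosh (Real.sqrt ((∑ l, q l ^ 2) + m2)) - 1) / Real.sqrt ((∑ l, q l ^ 2) + m2) ^ 3)
    (Real.sqrt ((∑ l, q l ^ 2) + m2)) (Finset.prod_nonneg fun l _ => sq_nonneg _) (by positivity) ha

/-- King's kernel is invariant under the site reflection. [cite: King1986, Thm 2.1 (2.22) p.654] -/
theorem kingKernel_siteReflection (m2 : ℝ) (z w : Fin (d + 1) → ℤ) :
    kingKernel m2 (((latticeTimeReflection (d + 1)).trans (Equiv.addRight (Pi.single 0 1 : Fin (d + 1) → ℤ))) z)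
      (((latticeTimeReflection (d + 1)).trans (Equiv.addRight (Pi.single 0 1 : Fin (d + 1) → ℤ))) w) = kingKernel m2 z w := by
  rw [siteReflection_apply, siteReflection_apply, kingKernel_apply, kingKernel_apply]
  have : Function.update w 0 (-w 0) - Function.update z 0 (-z 0) = latReflIdx 0 (w - z) := by
    funext μ
    by_cases h : μ = 0
    · subst h; simp [latReflIdx]; ring
    · simp [latReflIdx, h]
  rw [this, kingS2Inf_refl]

/-- The reflected Gram sums of King's kernel for the site reflection on `{x₀ ≥ 1}` are non-negative. [cite: King1986, Thm 2.1 (2.22) p.654, (4.5) p.670] -/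
theorem sum_sum_kingKernel_siteReflection_nonneg {m2 : ℝ} (hm : 0 < m2) (ι : Type) (s : Finset ι) (c : ι → ℝ) (z : ι → Fin (d + 1) → ℤ)
    (hz : ∀ i ∈ s, z i ∈ {x : Fin (d + 1) → ℤ | 1 ≤ x 0}) :
    0 ≤ ∑ i ∈ s, ∑ j ∈ s, c i * c j * kingKernel m2 (((latticeTimeReflection (d + 1)).trans (Equiv.addRight (Pi.single 0 1 : Fin (d + 1) → ℤ))) (z i)) (z j) := by
  have h := kingS2Inf_site_reflection_positive hm s c z fun i hi => hz i hi
  refine h.trans_eq (Finset.sum_congr rfl fun i _ => Finset.sum_congr rfl fun j _ => ?_)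
  rw [kingKernel_apply, siteReflection_apply, ← kingS2Inf_neg m2 (z j - _), neg_sub]

/-- ★★ **`μ_∞` IS REFLECTION POSITIVE FOR THE SITE REFLECTION `x₀ ↦ −x₀` ON ALL BOUNDED OBSERVABLES MEASURABLE IN `{φ(x) : x₀ ≥ 1}`** (continuum reflection positivity about
the hyperplane `t = ½`). [cite: King1986, Thm 2.1 (2.22) p.654; GlimmJaffe1987, §6.2 Thm. 6.2.2; FILS1978, §3] -/
theorem king_isReflectionPositive_site {m2 : ℝ} (hm : 0 < m2) :
    IsReflectionPositive (kingFieldInf (d := d) m2) ((latticeTimeReflection (d + 1)).trans (Equiv.addRight (Pi.single 0 1 : Fin (d + 1) → ℤ)))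
      {x : Fin (d + 1) → ℤ | 1 ≤ x 0} :=
  gaussianField_isReflectionPositive (isPosSemidefKernel_kingKernel hm) _ (kingKernel_siteReflection m2) siteReflection_involutive
    (sum_sum_kingKernel_siteReflection_nonneg hm)

/-! ## §3 The one-step shift is positive: `0 ≤ Re ∫ conj F(θφ)·F(Sφ) dμ_∞` -/

/-- The unit time shift pulls `{φ(x) : x₀ ≥ 0}`-measurable observables back to `{φ(x) : x₀ ≥ 1}`-measurable ones. [cite: GlimmJaffe1987, §6.1 (T(t)𝓔₊ ⊆ 𝓔₊)] -/
theorem measurable_comp_latticeTimeShift_site {G : ((Fin (d + 1) → ℤ) → ℝ) → ℂ} (hG : Measurable[positiveTimeEvents (d + 1) ℝ] G) :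
    Measurable[positiveEvents (S := ℝ) {x : Fin (d + 1) → ℤ | 1 ≤ x 0}] (G ∘ latticeTimeShift (d + 1) ℝ) := by
  have hS : Measurable[positiveEvents (S := ℝ) {x : Fin (d + 1) → ℤ | 1 ≤ x 0}, positiveTimeEvents (d + 1) ℝ] (latticeTimeShift (d + 1) ℝ) := by
    rw [measurable_cylinderEvents_iff]
    intro x hx
    have hx' : x + (Pi.single 0 1 : Fin (d + 1) → ℤ) ∈ {x : Fin (d + 1) → ℤ | 1 ≤ x 0} := by
      simp only [positiveTimeSites, Set.mem_setOf_eq, Pi.add_apply, Pi.single_eq_same] at hx ⊢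
      omega
    simpa using measurable_cylinderEvent_apply (X := fun _ : Fin (d + 1) → ℤ => ℝ) hx'
  exact @Measurable.comp _ _ _ (positiveEvents (S := ℝ) {x : Fin (d + 1) → ℤ | 1 ≤ x 0}) (positiveTimeEvents (d + 1) ℝ) _ _ _ hG hS

/-- `θ_site(x + e₀) = θ x`: reflecting `x + e₀` through `x₀ = 0` is reflecting `x` through `x₀ = −½`. [cite: FILS1978, §2] -/
theorem siteReflection_add_single (x : Fin (d + 1) → ℤ) :
    ((latticeTimeReflection (d + 1)).trans (Equiv.addRight (Pi.single 0 1 : Fin (d + 1) → ℤ))) (x + (Pi.single 0 1 : Fin (d + 1) → ℤ)) = latticeTimeReflection (d + 1) x := by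
  rw [siteReflection_apply, latticeTimeReflection_apply]
  ext j
  by_cases hj : j = 0
  · subst hj; simp; ring
  · simp [hj]

/-- ★★ **THE ONE-STEP SHIFT IS POSITIVE**: `0 ≤ Re ∫ conj F(φ∘θ)·F(Sφ) dμ_∞` for every bounded positive-time observable `F` — with `G = F ∘ S` (measurable in `{x₀ ≥ 1}`) this is
`Re ∫ conj G(φ∘θ_site)·G(φ) dμ_∞ ≥ 0`, the site reflection positivity of §2.  This is the premise making the reconstructed ONE-step transfer operator POSITIVE.
[cite: GlimmJaffe1987, §6.1 Thm. 6.1.3; FILS1978, §3 (site and bond reflections)] -/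
theorem king_shift_nonneg {m2 : ℝ} (hm : 0 < m2) (F : ((Fin (d + 1) → ℤ) → ℝ) → ℂ) (hF : IsBoundedMeasurable (positiveTimeEvents (d + 1) ℝ) F) :
    0 ≤ RCLike.re (∫ ω, starRingEnd ℂ (F (configReflect (latticeTimeReflection (d + 1)) ω)) * F (latticeTimeShift (d + 1) ℝ ω) ∂kingFieldInf m2) := by
  obtain ⟨hFm, C, hC⟩ := hF
  have hGm := measurable_comp_latticeTimeShift_site (d := d) hFm
  have h := king_isReflectionPositive_site (d := d) hm (F ∘ latticeTimeShift (d + 1) ℝ) hGm ⟨C, fun σ => hC _⟩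
  have hpt : ∀ σ : (Fin (d + 1) → ℤ) → ℝ,
      (F ∘ latticeTimeShift (d + 1) ℝ) (configReflect ((latticeTimeReflection (d + 1)).trans (Equiv.addRight (Pi.single 0 1 : Fin (d + 1) → ℤ))) σ)
        = F (configReflect (latticeTimeReflection (d + 1)) σ) := fun σ => by
    simp only [Function.comp_apply]
    congr 1
    funext x
    rw [latticeTimeShift_apply, configReflect_apply, configReflect_apply, siteReflection_add_single]
  simp_rw [hpt, Function.comp_apply] at h
  simpa only [RCLike.re_to_complex] using h

end Summit.QuantumFields.YangMills.BalabanUVNodes.N15KingModelRung.InfiniteVolume
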